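import Mathlib
import Literature.MathematicalPhysics.QuantumFieldTheory.MirrorRPKernel
import HarnessLib

/-!
# Planar four-line rigidity from the three analytic statements S1–S3: stub
# `stub_planarRigidityLemma` of line `entire-profile-null-growth` for crux `StableConeRPRigidity`
# (stmt-CriticalPhenomena-4800)

Statement (S4 of the line).  ASSUMING, as the three antecedents of the implication, S1 (per-mirror
half-plane continuation `t ↦ K (t n̂ + y)` of an even, half-space-bounded, mirror-invariant RP kernel,
with `|F t| ≤ K ((Re t) n̂)`), S2 (a continuous `π`-periodic profile with two incommensurable
mirror symmetries whose traces `κ (γⱼ + π/2 - θ) = (cos θ)^{-β} Fⱼ (tan θ)` come from right-half-plane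
holomorphic `Fⱼ = O((Re t)^{-β})` extends to an entire function of exponential type `β`) and S3
(a `T`-periodic entire function of exponential type `β`, `β T < 2π`, is constant): every continuous
positive kernel `k` on `ℝ² ∖ 0`, homogeneous of degree `-β`, `0 < β < 4`, invariant and reflection
positive (`IsMirrorRPKernel`) in the lines with normals `e₀, e₁, e₀ ± e₁`, is radial.

Proof (Euclidean bookkeeping in `ℝ² = EuclideanSpace ℝ (Fin 2)`, `eᵢ = EuclideanSpace.single i 1`).
* `k` is even (`θ_{e₀} θ_{e₁} = -id`); `|k| ≤ t₀^{-β} · max_{S¹} |k|` on `{⟪x, n̂⟫ ≥ t₀}` since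
  `‖x‖ ≥ ⟪x, n̂⟫` (homogeneity + compactness of the unit circle).
* S1 with `n = e₀`, `y = e₁` gives `F₁ (t) = k (t e₀ + e₁)`; S1 with `n = e₀ + e₁`,
  `y = (e₁ - e₀)/√2` gives `F₂ (t) = k (t n̂ + y)`; both with `|Fⱼ t| ≤ max(k e₀, k n̂) (Re t)^{-β}`.
* `κ ω := k (cos ω e₀ + sin ω e₁)` is continuous, `π`-periodic (evenness), `κ (π - ω) = κ ω`
  (mirror `e₀`), `κ (3π/2 - ω) = κ ω` (mirror `e₀ + e₁`), and
  `κ (γⱼ + π/2 - θ) = (cos θ)^{-β} Fⱼ (tan θ)` for `γ₁ = 0`, `γ₂ = π/4` because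
  `cos θ · (tan θ n̂ + u) = sin θ n̂ + cos θ u` is the point of the circle at angle `γⱼ + π/2 - θ`.
* S2 gives an entire `G` of exponential type `β` with `G = κ` on `ℝ`; the two symmetries compose
  to `κ (ω + π/2) = κ ω`, which propagates to `G` on `ℂ` by the identity theorem; S3 with
  `T = π/2` (`β π/2 < 2π ⇔ β < 4`) makes `G` constant, so `k` is constant on the unit circle,
  `k y = ‖y‖^{-β} k e₀`, and `k (R y) = k y` for every linear isometry `R`.
No new definitions; the three antecedents are used as hypotheses only (never proved here).
-/

open Filter Topology
open scoped InnerProductSpace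
open Literature.MathematicalPhysics.QuantumFieldTheory

namespace Summit.CriticalPhenomena.Ising3DConformalLimit.Cruxes.StableConeRPRigidity.EntireProfileNullGrowth

namespace PlanarRigidity

/-! ### Coordinates, mirrors and polar angles in `ℝ² = EuclideanSpace ℝ (Fin 2)` -/

/-- `⟪x, eᵢ⟫ = xᵢ`. -/
theorem inner_single_one_right (i : Fin 2) (x : EuclideanSpace ℝ (Fin 2)) :
    ⟪x, EuclideanSpace.single i (1 : ℝ)⟫_ℝ = x i := by
  rw [EuclideanSpace.inner_single_right]; simp

/-- `‖eᵢ‖ = 1`. -/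
theorem norm_single_one (i : Fin 2) :
    ‖(EuclideanSpace.single i 1 : EuclideanSpace ℝ (Fin 2))‖ = 1 := by simp

/-- Coordinate mirror `eᵢ`: sign flip of the `i`-th coordinate, `θ_{eᵢ} x = x - 2 xᵢ eᵢ`. -/
theorem refl_single (i : Fin 2) (x : EuclideanSpace ℝ (Fin 2)) :
    ((ℝ ∙ (EuclideanSpace.single i 1 : EuclideanSpace ℝ (Fin 2)))ᗮ).reflection x =
      x - (2 * x i) • EuclideanSpace.single i 1 := by
  -- adapted from Cruxes/StableConeRPRigidity/Disproof.lean `refl_coord`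
  rw [mirrorReflection_apply, inner_single_one_right, norm_single_one, one_pow, div_one]

/-- `‖e₀ + e₁‖ = √2`. -/
theorem norm_diag :
    ‖(EuclideanSpace.single 0 1 + EuclideanSpace.single 1 1 : EuclideanSpace ℝ (Fin 2))‖ =
      Real.sqrt 2 := by
  have h : ‖(EuclideanSpace.single 0 1 + EuclideanSpace.single 1 1 :
      EuclideanSpace ℝ (Fin 2))‖ ^ 2 = 2 := by
    rw [← real_inner_self_eq_norm_sq, inner_add_right, inner_single_one_right,
      inner_single_one_right]
    simp; norm_num
  rw [← Real.sqrt_sq (norm_nonneg (EuclideanSpace.single 0 1 + EuclideanSpace.single 1 1 :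
    EuclideanSpace ℝ (Fin 2))), h]

/-- `(√2)⁻¹ = √2 / 2`. -/
theorem inv_sqrt_two : (Real.sqrt 2)⁻¹ = Real.sqrt 2 / 2 := by
  have h : Real.sqrt 2 ≠ 0 := by positivity
  field_simp
  rw [Real.sq_sqrt (by norm_num)]

/-- Anti-diagonal mirror `e₀ + e₁`: `θ_{e₀+e₁} x = x - (x₀ + x₁)(e₀ + e₁)`, i.e.
`(x₀, x₁) ↦ (-x₁, -x₀)`. -/
theorem refl_diag (x : EuclideanSpace ℝ (Fin 2)) :
    ((ℝ ∙ (EuclideanSpace.single 0 1 + EuclideanSpace.single 1 1 :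
        EuclideanSpace ℝ (Fin 2)))ᗮ).reflection x =
      x - (x 0 + x 1) • (EuclideanSpace.single 0 1 + EuclideanSpace.single 1 1) := by
  -- adapted from Cruxes/StableConeRPRigidity/Disproof.lean `refl_add`
  rw [mirrorReflection_apply, inner_add_right, inner_single_one_right, inner_single_one_right,
    norm_diag, Real.sq_sqrt (by norm_num)]
  congr 1
  ring

/-- `θ_{e₀} θ_{e₁} = -id`: a kernel invariant under both coordinate mirrors is even. -/
theorem even_of_invariant {k : EuclideanSpace ℝ (Fin 2) → ℝ}
    (h0 : ∀ y, k (((ℝ ∙ EuclideanSpace.single 0 1)ᗮ).reflection y) = k y)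
    (h1 : ∀ y, k (((ℝ ∙ EuclideanSpace.single 1 1)ᗮ).reflection y) = k y)
    (x : EuclideanSpace ℝ (Fin 2)) : k (-x) = k x := by
  have key : -x = ((ℝ ∙ EuclideanSpace.single 0 1)ᗮ).reflection
      (((ℝ ∙ EuclideanSpace.single 1 1)ᗮ).reflection x) := by
    rw [refl_single, refl_single]
    ext j
    fin_cases j <;> simp <;> ring
  rw [key, h0, h1]

/-- The point of the unit circle at angle `ω` has norm `1`. -/
theorem norm_circle (ω : ℝ) : ‖(Real.cos ω • EuclideanSpace.single 0 1 +
    Real.sin ω • EuclideanSpace.single 1 1 : EuclideanSpace ℝ (Fin 2))‖ = 1 := by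
  have h : ‖(Real.cos ω • EuclideanSpace.single 0 1 +
      Real.sin ω • EuclideanSpace.single 1 1 : EuclideanSpace ℝ (Fin 2))‖ ^ 2 = 1 := by
    rw [EuclideanSpace.real_norm_sq_eq, Fin.sum_univ_two]
    simp [Real.cos_sq_add_sin_sq]
  nlinarith [norm_nonneg (Real.cos ω • EuclideanSpace.single 0 1 +
    Real.sin ω • EuclideanSpace.single 1 1 : EuclideanSpace ℝ (Fin 2))]

/-- The point of the unit circle at angle `ω` is not the origin. -/
theorem circle_ne_zero (ω : ℝ) : (Real.cos ω • EuclideanSpace.single 0 1 +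
    Real.sin ω • EuclideanSpace.single 1 1 : EuclideanSpace ℝ (Fin 2)) ≠ 0 := fun h => by
  simpa [h] using norm_circle ω

/-- Polar coordinates: every `x ≠ 0` is `‖x‖ (cos α e₀ + sin α e₁)`. -/
theorem exists_polar (x : EuclideanSpace ℝ (Fin 2)) (hx : x ≠ 0) : ∃ α : ℝ,
    x = ‖x‖ • (Real.cos α • EuclideanSpace.single 0 1 + Real.sin α • EuclideanSpace.single 1 1) := by
  -- adapted from Literature/Geometry/Lorentzian/PlaneWaveExterior.lean `lin_zero_eq_norm_mul_cos`
  set z : ℂ := ⟨x 0, x 1⟩ with hz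
  have hnorm : ‖z‖ = ‖x‖ := by
    rw [Complex.norm_eq_sqrt_sq_add_sq, EuclideanSpace.norm_eq, Fin.sum_univ_two]
    simp [hz, sq_abs]
  have hz0 : z ≠ 0 := by rw [← norm_ne_zero_iff, hnorm]; exact norm_ne_zero_iff.2 hx
  refine ⟨Complex.arg z, ?_⟩
  have hc : Real.cos (Complex.arg z) = x 0 / ‖x‖ := by rw [Complex.cos_arg hz0, hnorm]
  have hs : Real.sin (Complex.arg z) = x 1 / ‖x‖ := by rw [Complex.sin_arg, hnorm]
  have hxn : ‖x‖ ≠ 0 := norm_ne_zero_iff.2 hx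
  ext j
  fin_cases j <;> simp [hc, hs] <;> field_simp

/-- Mirror `e₀` on the circle: `ω ↦ π - ω`. -/
theorem refl_e0_circle (ω : ℝ) :
    ((ℝ ∙ EuclideanSpace.single 0 1)ᗮ).reflection (Real.cos ω • EuclideanSpace.single 0 1 +
        Real.sin ω • EuclideanSpace.single 1 1 : EuclideanSpace ℝ (Fin 2)) =
      Real.cos (Real.pi - ω) • EuclideanSpace.single 0 1 +
        Real.sin (Real.pi - ω) • EuclideanSpace.single 1 1 := by
  rw [refl_single, Real.cos_pi_sub, Real.sin_pi_sub]
  ext j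
  fin_cases j <;> simp [two_mul]

/-- Mirror `e₀ + e₁` on the circle: `ω ↦ 3π/2 - ω` (written `2·(π/4) + π - ω`). -/
theorem refl_diag_circle (ω : ℝ) :
    ((ℝ ∙ (EuclideanSpace.single 0 1 + EuclideanSpace.single 1 1 :
        EuclideanSpace ℝ (Fin 2)))ᗮ).reflection
        (Real.cos ω • EuclideanSpace.single 0 1 + Real.sin ω • EuclideanSpace.single 1 1) =
      Real.cos (2 * (Real.pi / 4) + Real.pi - ω) • EuclideanSpace.single 0 1 +
        Real.sin (2 * (Real.pi / 4) + Real.pi - ω) • EuclideanSpace.single 1 1 := by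
  rw [refl_diag, show 2 * (Real.pi / 4) + Real.pi - ω = (Real.pi - ω) + Real.pi / 2 by ring,
    Real.cos_add_pi_div_two, Real.sin_add_pi_div_two, Real.sin_pi_sub, Real.cos_pi_sub]
  ext j
  fin_cases j <;> simp

/-- Half turn on the circle: `ω ↦ ω + π` is `x ↦ -x`. -/
theorem circle_add_pi (ω : ℝ) :
    (Real.cos (ω + Real.pi) • EuclideanSpace.single 0 1 +
        Real.sin (ω + Real.pi) • EuclideanSpace.single 1 1 : EuclideanSpace ℝ (Fin 2)) =
      -(Real.cos ω • EuclideanSpace.single 0 1 + Real.sin ω • EuclideanSpace.single 1 1) := by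
  rw [Real.cos_add_pi, Real.sin_add_pi, neg_smul, neg_smul, neg_add]

/-- Trace point for the normal `e₀` (`γ₁ = 0`):
`cos θ · (tan θ e₀ + e₁)` is the circle point at angle `π/2 - θ`. -/
theorem trace_pt_one {θ : ℝ} (hc : Real.cos θ ≠ 0) :
    (Real.cos θ • (Real.tan θ • EuclideanSpace.single 0 1 + EuclideanSpace.single 1 1) :
        EuclideanSpace ℝ (Fin 2)) =
      Real.cos (0 + Real.pi / 2 - θ) • EuclideanSpace.single 0 1 +
        Real.sin (0 + Real.pi / 2 - θ) • EuclideanSpace.single 1 1 := by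
  have hsin : Real.cos θ * Real.tan θ = Real.sin θ := by rw [mul_comm, Real.tan_mul_cos hc]
  rw [zero_add, Real.cos_pi_div_two_sub, Real.sin_pi_div_two_sub, smul_add, smul_smul, hsin]

/-- Trace point for the normal `e₀ + e₁` (`γ₂ = π/4`, `n̂ = (e₀+e₁)/√2`, `u = (e₁-e₀)/√2`):
`cos θ · (tan θ n̂ + u)` is the circle point at angle `π/4 + π/2 - θ`. -/
theorem trace_pt_two {θ : ℝ} (hc : Real.cos θ ≠ 0) :
    (Real.cos θ • (Real.tan θ • (Real.sqrt 2 / 2) •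
          (EuclideanSpace.single 0 1 + EuclideanSpace.single 1 1) +
        (Real.sqrt 2 / 2) • (EuclideanSpace.single 1 1 - EuclideanSpace.single 0 1)) :
        EuclideanSpace ℝ (Fin 2)) =
      Real.cos (Real.pi / 4 + Real.pi / 2 - θ) • EuclideanSpace.single 0 1 +
        Real.sin (Real.pi / 4 + Real.pi / 2 - θ) • EuclideanSpace.single 1 1 := by
  have hsin : Real.cos θ * Real.tan θ = Real.sin θ := by rw [mul_comm, Real.tan_mul_cos hc]
  rw [show Real.pi / 4 + Real.pi / 2 - θ = Real.pi / 4 + (Real.pi / 2 - θ) by ring, Real.cos_add,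
    Real.sin_add, Real.cos_pi_div_two_sub, Real.sin_pi_div_two_sub, Real.cos_pi_div_four,
    Real.sin_pi_div_four]
  ext j
  fin_cases j <;> simp <;> linear_combination (Real.sqrt 2 / 2) * hsin

/-- `π/4 ∉ (π/2)ℤ`. -/
theorem pi_div_four_ne (m : ℤ) : Real.pi / 4 - 0 ≠ (m : ℝ) * (Real.pi / 2) := by
  intro hm
  have h1 : ((1 : ℝ) - 2 * m) * Real.pi = 0 := by linear_combination 4 * hm
  have h2 : (1 : ℝ) - 2 * m = 0 := (mul_eq_zero.1 h1).resolve_right Real.pi_ne_zero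
  have h3 : (1 : ℤ) = 2 * m := by exact_mod_cast (by linarith : (1 : ℝ) = 2 * m)
  omega

/-- Slab bound: a kernel continuous off `0` and homogeneous of degree `-β ≤ 0` is bounded on
every closed half-space `{⟪x, n̂⟫ ≥ t₀}`, `t₀ > 0` (there `‖x‖ ≥ t₀`, and `|k| ≤ max_{S¹} |k|`
on the unit circle by compactness). -/
theorem slab_bound {β : ℝ} {k : EuclideanSpace ℝ (Fin 2) → ℝ} (hβ : 0 ≤ β)
    (hkc : ContinuousOn k {0}ᶜ) (hhom : ∀ c : ℝ, 0 < c → ∀ y, k (c • y) = c ^ (-β) * k y)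
    (n : EuclideanSpace ℝ (Fin 2)) (t₀ : ℝ) (ht₀ : 0 < t₀) :
    ∃ M : ℝ, ∀ x : EuclideanSpace ℝ (Fin 2), t₀ ≤ ⟪x, ‖n‖⁻¹ • n⟫_ℝ → |k x| ≤ M := by
  obtain ⟨M₀, hM₀⟩ := (isCompact_sphere (0 : EuclideanSpace ℝ (Fin 2)) 1).exists_bound_of_continuousOn
    (hkc.mono fun x hx => by
      rw [Set.mem_compl_singleton_iff]
      rintro rfl
      simp at hx)
  refine ⟨t₀ ^ (-β) * M₀, fun x hx => ?_⟩
  have hn1 : ‖(‖n‖⁻¹ • n : EuclideanSpace ℝ (Fin 2))‖ ≤ 1 := by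
    rw [norm_smul, norm_inv, norm_norm, inv_mul_eq_div]; exact div_self_le_one _
  have hxn : t₀ ≤ ‖x‖ := by
    calc t₀ ≤ ⟪x, ‖n‖⁻¹ • n⟫_ℝ := hx
      _ ≤ ‖x‖ * ‖(‖n‖⁻¹ • n : EuclideanSpace ℝ (Fin 2))‖ := real_inner_le_norm _ _
      _ ≤ ‖x‖ * 1 := by gcongr
      _ = ‖x‖ := mul_one _
  have hxpos : 0 < ‖x‖ := ht₀.trans_le hxn
  have hu : ‖x‖⁻¹ • x ∈ Metric.sphere (0 : EuclideanSpace ℝ (Fin 2)) 1 := by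
    rw [mem_sphere_zero_iff_norm, norm_smul, norm_inv, norm_norm, inv_mul_cancel₀ hxpos.ne']
  have hk : k x = ‖x‖ ^ (-β) * k (‖x‖⁻¹ • x) := by
    conv_lhs => rw [show x = ‖x‖ • (‖x‖⁻¹ • x) by
      rw [smul_smul, mul_inv_cancel₀ hxpos.ne', one_smul]]
    exact hhom _ hxpos _
  rw [hk, abs_mul, abs_of_nonneg (Real.rpow_nonneg hxpos.le _)]
  have h1 : ‖x‖ ^ (-β) ≤ t₀ ^ (-β) := Real.rpow_le_rpow_of_nonpos ht₀ hxn (by linarith)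
  have h2 : |k (‖x‖⁻¹ • x)| ≤ M₀ := by simpa only [Real.norm_eq_abs] using hM₀ _ hu
  exact mul_le_mul h1 h2 (abs_nonneg _) (Real.rpow_nonneg ht₀.le _)

end PlanarRigidity

open PlanarRigidity in
/-- **S4 · planar four-line rigidity from S1–S3** (registered stub `stub_planarRigidityLemma` of
line `entire-profile-null-growth`, crux `PrecisionLaplacian.StableConeRPRigidity`; statement
verbatim): S1 → S2 → S3 → every continuous positive kernel on `ℝ² ∖ 0`, homogeneous of degree `-β`,
`0 < β < 4`, invariant and reflection positive in the lines with normals `e₀, e₁, e₀ ± e₁`, is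
invariant under all linear isometries of `ℝ²`.  Proof: see the module docstring. -/
theorem stub_planarRigidityLemma :
    (∀ (E : Type) [NormedAddCommGroup E] [InnerProductSpace ℝ E] (K : E → ℝ) (n : E), n ≠ 0 →
      ContinuousOn K {0}ᶜ → (∀ x, K (-x) = K x) →
      (∀ t₀ : ℝ, 0 < t₀ → ∃ M : ℝ, ∀ x : E, t₀ ≤ inner ℝ x (‖n‖⁻¹ • n) → |K x| ≤ M) →
      (∀ x, K (((ℝ ∙ n)ᗮ).reflection x) = K x) → Literature.MathematicalPhysics.QuantumFieldTheory.IsMirrorRPKernel n K →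
      ∀ y : E, inner ℝ y n = 0 →
        ∃ F : ℂ → ℂ, DifferentiableOn ℂ F {t : ℂ | 0 < t.re} ∧
          (∀ t : ℝ, 0 < t → F t = ((K (t • ‖n‖⁻¹ • n + y) : ℝ) : ℂ)) ∧
          (∀ t : ℂ, 0 < t.re → ‖F t‖ ≤ K (t.re • ‖n‖⁻¹ • n))) →
    (∀ (κ : ℝ → ℝ) (β γ₁ γ₂ C : ℝ) (F₁ F₂ : ℂ → ℂ), 0 ≤ β →
      Continuous κ → (∀ ω, κ (ω + Real.pi) = κ ω) →
      (∀ ω, κ (2 * γ₁ + Real.pi - ω) = κ ω) → (∀ ω, κ (2 * γ₂ + Real.pi - ω) = κ ω) →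
      (∀ k : ℤ, γ₂ - γ₁ ≠ (k : ℝ) * (Real.pi / 2)) →
      DifferentiableOn ℂ F₁ {t : ℂ | 0 < t.re} → DifferentiableOn ℂ F₂ {t : ℂ | 0 < t.re} →
      (∀ t : ℂ, 0 < t.re → ‖F₁ t‖ ≤ C * t.re ^ (-β)) → (∀ t : ℂ, 0 < t.re → ‖F₂ t‖ ≤ C * t.re ^ (-β)) →
      (∀ θ : ℝ, 0 < θ → θ < Real.pi / 2 →
        ((κ (γ₁ + Real.pi / 2 - θ) : ℝ) : ℂ) = ((Real.cos θ ^ (-β) : ℝ) : ℂ) * F₁ ((Real.tan θ : ℝ) : ℂ)) →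
      (∀ θ : ℝ, 0 < θ → θ < Real.pi / 2 →
        ((κ (γ₂ + Real.pi / 2 - θ) : ℝ) : ℂ) = ((Real.cos θ ^ (-β) : ℝ) : ℂ) * F₂ ((Real.tan θ : ℝ) : ℂ)) →
      ∃ G : ℂ → ℂ, Differentiable ℂ G ∧ (∀ ω : ℝ, G ω = ((κ ω : ℝ) : ℂ)) ∧
        ∃ C' : ℝ, ∀ ω : ℂ, ‖G ω‖ ≤ C' * Real.exp (β * |ω.im|)) →
    (∀ (G : ℂ → ℂ) (T β C : ℝ), 0 < T → 0 ≤ β → β * T < 2 * Real.pi → Differentiable ℂ G →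
      (∀ ω : ℂ, G (ω + T) = G ω) → (∀ ω : ℂ, ‖G ω‖ ≤ C * Real.exp (β * |ω.im|)) →
      ∀ z w : ℂ, G z = G w) →
    ∀ (β : ℝ) (k : EuclideanSpace ℝ (Fin 2) → ℝ), 0 < β → β < 4 →
      ContinuousOn k {0}ᶜ → (∀ y, y ≠ 0 → 0 < k y) →
      (∀ c : ℝ, 0 < c → ∀ y, k (c • y) = c ^ (-β) * k y) →
      (∀ ℓ : EuclideanSpace ℝ (Fin 2), (ℓ = EuclideanSpace.single 0 1 ∨ ℓ = EuclideanSpace.single 1 1 ∨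
        ℓ = EuclideanSpace.single 0 1 + EuclideanSpace.single 1 1 ∨ ℓ = EuclideanSpace.single 0 1 - EuclideanSpace.single 1 1) →
        (∀ y, k (((ℝ ∙ ℓ)ᗮ).reflection y) = k y) ∧ Literature.MathematicalPhysics.QuantumFieldTheory.IsMirrorRPKernel ℓ k) →
      ∀ (R : EuclideanSpace ℝ (Fin 2) ≃ₗᵢ[ℝ] EuclideanSpace ℝ (Fin 2)) (y : EuclideanSpace ℝ (Fin 2)), k (R y) = k y := by
  intro h₁ h₂ h₃ β k hβ hβ4 hkc _ hhom hmir R y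
  -- the mirrors used: `e₀` (invariance + RP), `e₁` (invariance), `e₀ + e₁` (invariance + RP)
  have hm0 := hmir (EuclideanSpace.single 0 1) (Or.inl rfl)
  have hm1 := hmir (EuclideanSpace.single 1 1) (Or.inr (Or.inl rfl))
  have hmd := hmir (EuclideanSpace.single 0 1 + EuclideanSpace.single 1 1)
    (Or.inr (Or.inr (Or.inl rfl)))
  -- evenness and slab bounds (the hypotheses of S1)
  have heven : ∀ x, k (-x) = k x := even_of_invariant hm0.1 hm1.1
  have hslab := fun n : EuclideanSpace ℝ (Fin 2) => slab_bound hβ.le hkc hhom n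
  -- S1 for the normal `e₀` with the offset `e₁`
  obtain ⟨F₁, hF₁d, hF₁eq, hF₁le⟩ := h₁ (EuclideanSpace ℝ (Fin 2)) k (EuclideanSpace.single 0 1)
    (by simp) hkc heven (hslab _) hm0.1 hm0.2 (EuclideanSpace.single 1 1)
    (by rw [inner_single_one_right]; simp)
  simp only [norm_single_one, inv_one, one_smul] at hF₁eq hF₁le
  -- S1 for the normal `e₀ + e₁` with the offset `(e₁ - e₀)/√2`
  obtain ⟨F₂, hF₂d, hF₂eq, hF₂le⟩ := h₁ (EuclideanSpace ℝ (Fin 2)) k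
    (EuclideanSpace.single 0 1 + EuclideanSpace.single 1 1)
    (by
      intro h
      have := congrArg (fun v : EuclideanSpace ℝ (Fin 2) => v 0) h
      simp at this)
    hkc heven (hslab _) hmd.1 hmd.2
    ((Real.sqrt 2 / 2) • (EuclideanSpace.single 1 1 - EuclideanSpace.single 0 1))
    (by
      rw [real_inner_smul_left, inner_add_right, inner_single_one_right, inner_single_one_right]
      simp)
  simp only [norm_diag, inv_sqrt_two] at hF₂eq hF₂le
  -- the angular profile `κ ω = k (cos ω e₀ + sin ω e₁)`
  obtain ⟨κ, hκ⟩ : ∃ κ : ℝ → ℝ, ∀ ω, κ ω =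
      k (Real.cos ω • EuclideanSpace.single 0 1 + Real.sin ω • EuclideanSpace.single 1 1) :=
    ⟨_, fun _ => rfl⟩
  have hκc : Continuous κ := by
    rw [show κ = fun ω =>
        k (Real.cos ω • EuclideanSpace.single 0 1 + Real.sin ω • EuclideanSpace.single 1 1) from
      funext hκ]
    exact hkc.comp_continuous (by fun_prop) fun ω => circle_ne_zero ω
  have hκπ : ∀ ω, κ (ω + Real.pi) = κ ω := fun ω => by
    rw [hκ, hκ, circle_add_pi, heven]
  have hκs1 : ∀ ω, κ (2 * 0 + Real.pi - ω) = κ ω := fun ω => by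
    rw [show (2 : ℝ) * 0 + Real.pi - ω = Real.pi - ω by ring, hκ, hκ, ← refl_e0_circle, hm0.1]
  have hκs2 : ∀ ω, κ (2 * (Real.pi / 4) + Real.pi - ω) = κ ω := fun ω => by
    rw [hκ, hκ, ← refl_diag_circle, hmd.1]
  -- growth of the two traces: `|Fⱼ t| ≤ k ((Re t) n̂ⱼ) = (Re t)^{-β} k n̂ⱼ ≤ C (Re t)^{-β}`
  obtain ⟨C, hC1, hC2⟩ : ∃ C : ℝ, k (EuclideanSpace.single 0 1) ≤ C ∧
      k ((Real.sqrt 2 / 2) • (EuclideanSpace.single 0 1 + EuclideanSpace.single 1 1)) ≤ C :=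
    ⟨max _ _, le_max_left _ _, le_max_right _ _⟩
  have hF₁g : ∀ t : ℂ, 0 < t.re → ‖F₁ t‖ ≤ C * t.re ^ (-β) := fun t ht => by
    calc ‖F₁ t‖ ≤ k (t.re • EuclideanSpace.single 0 1) := hF₁le t ht
      _ = t.re ^ (-β) * k (EuclideanSpace.single 0 1) := hhom _ ht _
      _ ≤ t.re ^ (-β) * C := mul_le_mul_of_nonneg_left hC1 (Real.rpow_nonneg ht.le _)
      _ = C * t.re ^ (-β) := mul_comm _ _
  have hF₂g : ∀ t : ℂ, 0 < t.re → ‖F₂ t‖ ≤ C * t.re ^ (-β) := fun t ht => by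
    calc ‖F₂ t‖ ≤ k (t.re • (Real.sqrt 2 / 2) •
          (EuclideanSpace.single 0 1 + EuclideanSpace.single 1 1)) := hF₂le t ht
      _ = t.re ^ (-β) *
          k ((Real.sqrt 2 / 2) • (EuclideanSpace.single 0 1 + EuclideanSpace.single 1 1)) :=
        hhom _ ht _
      _ ≤ t.re ^ (-β) * C := mul_le_mul_of_nonneg_left hC2 (Real.rpow_nonneg ht.le _)
      _ = C * t.re ^ (-β) := mul_comm _ _
  -- the two traces: `κ (γⱼ + π/2 - θ) = (cos θ)^{-β} Fⱼ (tan θ)` by homogeneity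
  have htr1 : ∀ θ : ℝ, 0 < θ → θ < Real.pi / 2 → ((κ (0 + Real.pi / 2 - θ) : ℝ) : ℂ) =
      ((Real.cos θ ^ (-β) : ℝ) : ℂ) * F₁ ((Real.tan θ : ℝ) : ℂ) := by
    intro θ hθ0 hθ1
    have hcos : 0 < Real.cos θ := Real.cos_pos_of_mem_Ioo ⟨by linarith [Real.pi_pos], hθ1⟩
    rw [hF₁eq _ (Real.tan_pos_of_pos_of_lt_pi_div_two hθ0 hθ1), ← Complex.ofReal_mul,
      ← hhom _ hcos, trace_pt_one hcos.ne', hκ]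
  have htr2 : ∀ θ : ℝ, 0 < θ → θ < Real.pi / 2 → ((κ (Real.pi / 4 + Real.pi / 2 - θ) : ℝ) : ℂ) =
      ((Real.cos θ ^ (-β) : ℝ) : ℂ) * F₂ ((Real.tan θ : ℝ) : ℂ) := by
    intro θ hθ0 hθ1
    have hcos : 0 < Real.cos θ := Real.cos_pos_of_mem_Ioo ⟨by linarith [Real.pi_pos], hθ1⟩
    rw [hF₂eq _ (Real.tan_pos_of_pos_of_lt_pi_div_two hθ0 hθ1), ← Complex.ofReal_mul,
      ← hhom _ hcos, trace_pt_two hcos.ne', hκ]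
  -- S2: the profile is the restriction of an entire function of exponential type `β`
  obtain ⟨G, hGd, hGκ, C', hGle⟩ := h₂ κ β 0 (Real.pi / 4) C F₁ F₂ hβ.le hκc hκπ hκs1 hκs2
    (fun m => pi_div_four_ne m) hF₁d hF₂d hF₁g hF₂g htr1 htr2
  -- the two symmetries compose to the quarter turn: `κ (ω + π/2) = κ ω`, hence for `G` on `ℂ`
  have hκq : ∀ ω : ℝ, κ (ω + Real.pi / 2) = κ ω := fun ω => by
    have h1 := hκs2 (Real.pi - ω)
    have h2 := hκs1 ω
    rw [show 2 * (Real.pi / 4) + Real.pi - (Real.pi - ω) = ω + Real.pi / 2 by ring] at h1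
    rw [show (2 : ℝ) * 0 + Real.pi - ω = Real.pi - ω by ring] at h2
    rw [h1, h2]
  have hGq : ∀ ω : ℂ, G (ω + ((Real.pi / 2 : ℝ) : ℂ)) = G ω := by
    have hident : (fun ω => G (ω + ((Real.pi / 2 : ℝ) : ℂ))) = G := by
      refine AnalyticOnNhd.eq_of_frequently_eq (z₀ := (0 : ℂ))
        (Complex.analyticOnNhd_univ_iff_differentiable.2
          (hGd.comp (differentiable_id.add (differentiable_const _))))
        (Complex.analyticOnNhd_univ_iff_differentiable.2 hGd) ?_
      -- frequently along the reals near `0`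
      have ht : Tendsto (fun w : ℝ => (w : ℂ)) (𝓝[≠] 0) (𝓝[≠] 0) := by
        refine tendsto_nhdsWithin_of_tendsto_nhds_of_eventually_within _
          ((Complex.continuous_ofReal.tendsto' 0 0 (by simp)).mono_left nhdsWithin_le_nhds) ?_
        filter_upwards [self_mem_nhdsWithin] with w hw
        simpa using hw
      refine ht.frequently (Filter.Eventually.of_forall fun w => ?_).frequently
      show G ((w : ℂ) + ((Real.pi / 2 : ℝ) : ℂ)) = G w
      rw [← Complex.ofReal_add, hGκ, hGκ, hκq]
    exact fun ω => congrFun hident ω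
  -- S3 with `T = π/2` (`β π/2 < 2π ⇔ β < 4`): `G` is constant
  have hT : β * (Real.pi / 2) < 2 * Real.pi := by
    have := mul_lt_mul_of_pos_right hβ4 (half_pos Real.pi_pos)
    linarith
  have hconst := h₃ G (Real.pi / 2) β C' (half_pos Real.pi_pos) hβ.le hT hGd hGq hGle
  -- hence `k` is constant on the unit circle and `k x = ‖x‖^{-β} k e₀`
  have hk0 : ∀ ω : ℝ,
      k (Real.cos ω • EuclideanSpace.single 0 1 + Real.sin ω • EuclideanSpace.single 1 1) =
        k (EuclideanSpace.single 0 1) := by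
    intro ω
    have h := hconst (ω : ℂ) ((0 : ℝ) : ℂ)
    rw [hGκ, hGκ, Complex.ofReal_inj, hκ, hκ, Real.cos_zero, Real.sin_zero, one_smul, zero_smul,
      add_zero] at h
    exact h
  have hrad : ∀ x : EuclideanSpace ℝ (Fin 2), x ≠ 0 →
      k x = ‖x‖ ^ (-β) * k (EuclideanSpace.single 0 1) := by
    intro x hx
    obtain ⟨α, hα⟩ := exists_polar x hx
    conv_lhs => rw [hα]
    rw [hhom _ (norm_pos_iff.2 hx), hk0]
  by_cases hy : y = 0
  · simp [hy]
  · have hRy : R y ≠ 0 := fun h => hy (by simpa using congrArg R.symm h)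
    rw [hrad y hy, hrad (R y) hRy, LinearIsometryEquiv.norm_map]

end Summit.CriticalPhenomena.Ising3DConformalLimit.Cruxes.StableConeRPRigidity.EntireProfileNullGrowth
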